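import Mathlib

/-!
# Closure of B's position family under the chart substitutions — stub `stub_closure` of line `refutation-cuspidal-edge` (crux stmt-ResolutionOfSingularities-18182, route ShadowGame)

B's positions are `Pos a e b U E = x · (x^a z^{2e} U y² − x^b W³)^p · E^p`, `W = z − x − xz`
(`x = X 0`, `y = X 1`, `z = X 2`; `U`, `E` units of `MvPowerSeries (Fin 3) κ`). We prove that the
four substitutions `![x, xy, x(z+1)]`, `![x, y, x(z+1)]`, `![x, xy, z]`, `![x, zy, z]` (B's answers
to the centres `{x,y,z}`, `{x,z}`, `{x,y}`, `{y,z}`) map a position to `x^{p·m}` times a position,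
with the unit bookkeeping, and the analogous factoring for the centre `{x}`. Since
`MvPowerSeries.subst` along a family with zero constant coefficients is an algebra homomorphism
(`subst_mul`, `subst_pow`, `subst_sub`, `subst_X`), everything reduces to `ring` identities plus
factoring out `x ^ min s t`.
-/

noncomputable section

set_option linter.dupNamespace false

namespace Summit.ResolutionOfSingularities.ResolutionOfSingularities.Theorems.ShadowGameWinR.Negative

open MvPowerSeries

/-- Factoring the common power `x ^ m`, `m = min s t`, out of a position:
`x · (x^s Z V Y − x^t Q)^p · F^p = x^{p·m} · (x · (x^{s-m} Z V Y − x^{t-m} Q)^p · F^p)`. [folklore] -/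
theorem pos_factor_min {R : Type*} [CommRing R] (x Z V Y Q F : R) (s t p : ℕ) :
    x * (x ^ s * Z * V * Y - x ^ t * Q) ^ p * F ^ p =
      x ^ (p * min s t) *
        (x * (x ^ (s - min s t) * Z * V * Y - x ^ (t - min s t) * Q) ^ p * F ^ p) := by
  have hs : x ^ s = x ^ min s t * x ^ (s - min s t) := by
    rw [← pow_add, Nat.add_sub_of_le (min_le_left s t)]
  have ht : x ^ t = x ^ min s t * x ^ (t - min s t) := by
    rw [← pow_add, Nat.add_sub_of_le (min_le_right s t)]
  have h : x ^ s * Z * V * Y - x ^ t * Q =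
      x ^ min s t * (x ^ (s - min s t) * Z * V * Y - x ^ (t - min s t) * Q) := by
    rw [hs, ht]; ring
  rw [h, mul_pow, ← pow_mul]
  ring

/-- `MvPowerSeries.subst` along a substitutable family is a ring homomorphism: the image of
`Pos a e b U E` in terms of the images of `x, y, z, U, E`. [folklore] -/
theorem subst_pos {κ : Type*} [CommRing κ] {σ : Fin 3 → MvPowerSeries (Fin 3) κ}
    (ha : HasSubst σ) (p a e b : ℕ) (U E : MvPowerSeries (Fin 3) κ) :
    subst σ
        (X 0 * (X 0 ^ a * X 2 ^ (2 * e) * U * X 1 ^ 2 - X 0 ^ b * (X 2 - X 0 - X 0 * X 2) ^ 3) ^ p *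
          E ^ p) =
      σ 0 * (σ 0 ^ a * σ 2 ^ (2 * e) * subst σ U * σ 1 ^ 2 - σ 0 ^ b * (σ 2 - σ 0 - σ 0 * σ 2) ^ 3) ^ p *
        subst σ E ^ p := by
  simp only [subst_mul ha, subst_sub ha, subst_pow ha, subst_X ha]

/-- The point-centre substitution `![x, xy, x(z+1)]` is substitutable. [folklore] -/
theorem hasSubst_P {κ : Type*} [CommRing κ] :
    HasSubst (![X 0, X 0 * X 1, X 0 * (X 2 + 1)] : Fin 3 → MvPowerSeries (Fin 3) κ) :=
  hasSubst_of_constantCoeff_zero fun s => by fin_cases s <;> simp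

/-- The `{x,z}`-centre substitution `![x, y, x(z+1)]` is substitutable. [folklore] -/
theorem hasSubst_Ly {κ : Type*} [CommRing κ] :
    HasSubst (![X 0, X 1, X 0 * (X 2 + 1)] : Fin 3 → MvPowerSeries (Fin 3) κ) :=
  hasSubst_of_constantCoeff_zero fun s => by fin_cases s <;> simp

/-- The `{x,y}`-centre substitution `![x, xy, z]` is substitutable. [folklore] -/
theorem hasSubst_Lz {κ : Type*} [CommRing κ] :
    HasSubst (![X 0, X 0 * X 1, X 2] : Fin 3 → MvPowerSeries (Fin 3) κ) :=
  hasSubst_of_constantCoeff_zero fun s => by fin_cases s <;> simp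

/-- The `{y,z}`-centre substitution `![x, zy, z]` is substitutable. [folklore] -/
theorem hasSubst_Lx {κ : Type*} [CommRing κ] :
    HasSubst (![X 0, X 2 * X 1, X 2] : Fin 3 → MvPowerSeries (Fin 3) κ) :=
  hasSubst_of_constantCoeff_zero fun s => by fin_cases s <;> simp

/-- Point centre `{x,y,z}`, chart `x`, `τ = (0,0,1)`: the image of a position (unfactored). [folklore] -/
theorem substP_pos {κ : Type*} [CommRing κ] (p a e b : ℕ) (U E : MvPowerSeries (Fin 3) κ) :
    subst (![X 0, X 0 * X 1, X 0 * (X 2 + 1)] : Fin 3 → MvPowerSeries (Fin 3) κ)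
        (X 0 * (X 0 ^ a * X 2 ^ (2 * e) * U * X 1 ^ 2 - X 0 ^ b * (X 2 - X 0 - X 0 * X 2) ^ 3) ^ p *
          E ^ p) =
      X 0 * (X 0 ^ (a + 2 * e + 2) * X 2 ^ (2 * 0) *
            ((X 2 + 1) ^ (2 * e) *
              subst (![X 0, X 0 * X 1, X 0 * (X 2 + 1)] : Fin 3 → MvPowerSeries (Fin 3) κ) U) *
            X 1 ^ 2 -
          X 0 ^ (b + 3) * (X 2 - X 0 - X 0 * X 2) ^ 3) ^ p *
        subst (![X 0, X 0 * X 1, X 0 * (X 2 + 1)] : Fin 3 → MvPowerSeries (Fin 3) κ) E ^ p := by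
  rw [subst_pos hasSubst_P]
  simp only [Matrix.cons_val_zero, Matrix.cons_val_one, Matrix.cons_val_two, Matrix.head_cons,
    Matrix.tail_cons, mul_pow]
  ring

/-- Centre `{x,z}`, chart `x`, `τ_z = 1`: the image of a position (unfactored). [folklore] -/
theorem substLy_pos {κ : Type*} [CommRing κ] (p a e b : ℕ) (U E : MvPowerSeries (Fin 3) κ) :
    subst (![X 0, X 1, X 0 * (X 2 + 1)] : Fin 3 → MvPowerSeries (Fin 3) κ)
        (X 0 * (X 0 ^ a * X 2 ^ (2 * e) * U * X 1 ^ 2 - X 0 ^ b * (X 2 - X 0 - X 0 * X 2) ^ 3) ^ p *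
          E ^ p) =
      X 0 * (X 0 ^ (a + 2 * e) * X 2 ^ (2 * 0) *
            ((X 2 + 1) ^ (2 * e) *
              subst (![X 0, X 1, X 0 * (X 2 + 1)] : Fin 3 → MvPowerSeries (Fin 3) κ) U) *
            X 1 ^ 2 -
          X 0 ^ (b + 3) * (X 2 - X 0 - X 0 * X 2) ^ 3) ^ p *
        subst (![X 0, X 1, X 0 * (X 2 + 1)] : Fin 3 → MvPowerSeries (Fin 3) κ) E ^ p := by
  rw [subst_pos hasSubst_Ly]
  simp only [Matrix.cons_val_zero, Matrix.cons_val_one, Matrix.cons_val_two, Matrix.head_cons,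
    Matrix.tail_cons, mul_pow]
  ring

/-- Centre `{x,y}`, chart `x`, `τ_y = 0`: the image of a position (unfactored). [folklore] -/
theorem substLz_pos {κ : Type*} [CommRing κ] (p a e b : ℕ) (U E : MvPowerSeries (Fin 3) κ) :
    subst (![X 0, X 0 * X 1, X 2] : Fin 3 → MvPowerSeries (Fin 3) κ)
        (X 0 * (X 0 ^ a * X 2 ^ (2 * e) * U * X 1 ^ 2 - X 0 ^ b * (X 2 - X 0 - X 0 * X 2) ^ 3) ^ p *
          E ^ p) =
      X 0 * (X 0 ^ (a + 2) * X 2 ^ (2 * e) *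
              subst (![X 0, X 0 * X 1, X 2] : Fin 3 → MvPowerSeries (Fin 3) κ) U * X 1 ^ 2 -
          X 0 ^ b * (X 2 - X 0 - X 0 * X 2) ^ 3) ^ p *
        subst (![X 0, X 0 * X 1, X 2] : Fin 3 → MvPowerSeries (Fin 3) κ) E ^ p := by
  rw [subst_pos hasSubst_Lz]
  simp only [Matrix.cons_val_zero, Matrix.cons_val_one, Matrix.cons_val_two, Matrix.head_cons,
    Matrix.tail_cons, mul_pow]
  ring

/-- Centre `{y,z}`, chart `z`, `τ_y = 0`: the image of a position is a position. [folklore] -/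
theorem substLx_pos {κ : Type*} [CommRing κ] (p a e b : ℕ) (U E : MvPowerSeries (Fin 3) κ) :
    subst (![X 0, X 2 * X 1, X 2] : Fin 3 → MvPowerSeries (Fin 3) κ)
        (X 0 * (X 0 ^ a * X 2 ^ (2 * e) * U * X 1 ^ 2 - X 0 ^ b * (X 2 - X 0 - X 0 * X 2) ^ 3) ^ p *
          E ^ p) =
      X 0 * (X 0 ^ a * X 2 ^ (2 * (e + 1)) *
              subst (![X 0, X 2 * X 1, X 2] : Fin 3 → MvPowerSeries (Fin 3) κ) U * X 1 ^ 2 -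
          X 0 ^ b * (X 2 - X 0 - X 0 * X 2) ^ 3) ^ p *
        subst (![X 0, X 2 * X 1, X 2] : Fin 3 → MvPowerSeries (Fin 3) κ) E ^ p := by
  rw [subst_pos hasSubst_Lx]
  simp only [Matrix.cons_val_zero, Matrix.cons_val_one, Matrix.cons_val_two, Matrix.head_cons,
    Matrix.tail_cons, mul_pow]
  ring

/-- `z + 1` is a unit of the power-series ring (constant coefficient `1`). [folklore] -/
theorem isUnit_X_two_add_one {κ : Type*} [CommRing κ] :
    IsUnit (X 2 + 1 : MvPowerSeries (Fin 3) κ) :=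
  MvPowerSeries.isUnit_iff_constantCoeff.mpr (by simp)

/-- The image of a unit under a substitution (an algebra homomorphism) is a unit. [folklore] -/
theorem isUnit_subst {κ : Type*} [CommRing κ] {σ : Fin 3 → MvPowerSeries (Fin 3) κ}
    (ha : HasSubst σ) {U : MvPowerSeries (Fin 3) κ} (hU : IsUnit U) : IsUnit (subst σ U) := by
  simpa only [substAlgHom_apply] using hU.map (substAlgHom ha)

/-- STUB S9a (closure of the position family under B's answers): the substitution identities for
`Pos a e b U E = x · Π^p · E^p`, `Π = x^a z^{2e} U y² − x^b W³`, `W = z − x − x z`, under the four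
chart maps, with the unit bookkeeping, and the factoring for the centre `{x}`. [folklore] -/
theorem stub_closure (p : ℕ) [Fact p.Prime] (κ : Type) [Field κ] [CharP κ p] (a e b : ℕ) (U E : MvPowerSeries (Fin 3) κ) (hU : IsUnit U) (hE : IsUnit E) :
    let W : MvPowerSeries (Fin 3) κ := X 2 - X 0 - X 0 * X 2
    let Pos : ℕ → ℕ → ℕ → MvPowerSeries (Fin 3) κ → MvPowerSeries (Fin 3) κ → MvPowerSeries (Fin 3) κ :=
      fun a e b U E => X 0 * (X 0 ^ a * X 2 ^ (2 * e) * U * X 1 ^ 2 - X 0 ^ b * W ^ 3) ^ p * E ^ p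
    let σP : Fin 3 → MvPowerSeries (Fin 3) κ := ![X 0, X 0 * X 1, X 0 * (X 2 + 1)]
    let σLy : Fin 3 → MvPowerSeries (Fin 3) κ := ![X 0, X 1, X 0 * (X 2 + 1)]
    let σLz : Fin 3 → MvPowerSeries (Fin 3) κ := ![X 0, X 0 * X 1, X 2]
    let σLx : Fin 3 → MvPowerSeries (Fin 3) κ := ![X 0, X 2 * X 1, X 2]
    -- point centre {x,y,z}, chart x, τ = (0,0,1)
    (subst σP (Pos a e b U E) =
       X 0 ^ (p * min (a + 2 * e + 2) (b + 3)) *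
         Pos (a + 2 * e + 2 - min (a + 2 * e + 2) (b + 3)) 0 (b + 3 - min (a + 2 * e + 2) (b + 3))
           ((X 2 + 1) ^ (2 * e) * subst σP U) (subst σP E)
     ∧ IsUnit ((X 2 + 1) ^ (2 * e) * subst σP U) ∧ IsUnit (subst σP E)) ∧
    -- centre {x,z}, chart x, τ_z = 1
    (subst σLy (Pos a e b U E) =
       X 0 ^ (p * min (a + 2 * e) (b + 3)) *
         Pos (a + 2 * e - min (a + 2 * e) (b + 3)) 0 (b + 3 - min (a + 2 * e) (b + 3))
           ((X 2 + 1) ^ (2 * e) * subst σLy U) (subst σLy E)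
     ∧ IsUnit ((X 2 + 1) ^ (2 * e) * subst σLy U) ∧ IsUnit (subst σLy E)) ∧
    -- centre {x,y}, chart x, τ_y = 0
    (subst σLz (Pos a e b U E) =
       X 0 ^ (p * min (a + 2) b) * Pos (a + 2 - min (a + 2) b) e (b - min (a + 2) b) (subst σLz U) (subst σLz E)
     ∧ IsUnit (subst σLz U) ∧ IsUnit (subst σLz E)) ∧
    -- centre {y,z}, chart z, τ_y = 0
    (subst σLx (Pos a e b U E) = Pos a (e + 1) b (subst σLx U) (subst σLx E)
     ∧ IsUnit (subst σLx U) ∧ IsUnit (subst σLx E)) ∧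
    -- centre {x}: the position is x^{p·min a b} times a position
    (Pos a e b U E = X 0 ^ (p * min a b) * Pos (a - min a b) e (b - min a b) U E) := by
  intro W Pos σP σLy σLz σLx
  have hP : HasSubst σP := hasSubst_P
  have hLy : HasSubst σLy := hasSubst_Ly
  have hLz : HasSubst σLz := hasSubst_Lz
  have hLx : HasSubst σLx := hasSubst_Lx
  refine ⟨⟨?_, (isUnit_X_two_add_one.pow _).mul (isUnit_subst hP hU), isUnit_subst hP hE⟩,
    ⟨?_, (isUnit_X_two_add_one.pow _).mul (isUnit_subst hLy hU), isUnit_subst hLy hE⟩,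
    ⟨?_, isUnit_subst hLz hU, isUnit_subst hLz hE⟩,
    ⟨?_, isUnit_subst hLx hU, isUnit_subst hLx hE⟩, ?_⟩
  · exact (substP_pos p a e b U E).trans
      (pos_factor_min (X 0) (X 2 ^ (2 * 0)) ((X 2 + 1) ^ (2 * e) * subst σP U) (X 1 ^ 2) (W ^ 3)
        (subst σP E) (a + 2 * e + 2) (b + 3) p)
  · exact (substLy_pos p a e b U E).trans
      (pos_factor_min (X 0) (X 2 ^ (2 * 0)) ((X 2 + 1) ^ (2 * e) * subst σLy U) (X 1 ^ 2) (W ^ 3)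
        (subst σLy E) (a + 2 * e) (b + 3) p)
  · exact (substLz_pos p a e b U E).trans
      (pos_factor_min (X 0) (X 2 ^ (2 * e)) (subst σLz U) (X 1 ^ 2) (W ^ 3) (subst σLz E)
        (a + 2) b p)
  · exact substLx_pos p a e b U E
  · exact pos_factor_min (X 0) (X 2 ^ (2 * e)) U (X 1 ^ 2) (W ^ 3) E a b p

end Summit.ResolutionOfSingularities.ResolutionOfSingularities.Theorems.ShadowGameWinR.Negative

end
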